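import Mathlib
import Literature.Computability.Complexity.ExtMonotoneGates
import Literature.Computability.Complexity.CliqueApproximatorsWide
import Literature.Computability.Complexity.MonotoneApproximation
import Literature.Computability.Complexity.RossmanMonotoneCliqueProb
import Summits.PneNP.PneNP.Theses.ConvexRankGates

/-!
# drefute gen 2 — SG holds for every term gate of small monotone complexity over its own atoms
(modulo the line's `stub_pluckingBound`; Lean, 0 sorry)

For the lead of line `dnf-invariant-wide-gates-see-small-cliques` (crux stmt-PneNP-10681). The tree's generic
approximation method `ApproxScheme.exists_approx_circuit` is instantiated with
* inputs = the clique ATOMS `⌈Y⌉`, `Y ∈ 𝒱(l)` (type `Atom m l`), approximated EXACTLY by the closed principal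
  up-set `atomFamily l Y` (no `∧`-gates spent on building atoms from edges);
* approximators = closed families of `K(m, r, l)`, `⊔ = closure ∘ ∪`, `⊓ = ∩`;
* positives = bare `k`-cliques (weight 1), negatives = ALL graphs weighted by the product measure `pw q`;
so that for any Boolean function `O` of graphs computed from the atom vector by a `{∧₂, ∨₂}`-circuit `C`
(`exists_closed_approx_of_monotoneCircuit`):
  `∃ F closed, #lostPos m k O F ≤ C.size · ((r-1)^l)^2 · C(m-l-1, k-l-1)` (tree `card_errPos_le_wide`) and
  `gainedNeg m q O F ≤ C.size · pluck`, where `pluck` is ANY uniform bound on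
  `Pr_q[⌈closure r l 𝒞⌉ ∧ ¬⌈𝒞⌉]`, `𝒞 ⊆ 𝒱(l)` — i.e. exactly the line's `stub_pluckingBound` with
  `pluck = #𝒱(l)·(1 - q^{C(l,2)})^r`.
Corollary `sgGoal_of_monotoneCircuit`: the SG goal for `O` (the conclusion of `SGAt`, verbatim `lostPos`/`gainedNeg`)
as soon as `C.size · trim ≤ ε·C(m,k)` and `C.size · pluck ≤ ε`. Since `SGAt` does not mention `r`, the lead may take
`r` as large as the trimming budget allows: with the regime of `stub_denseRegime` this proves SG for every PERM/GRANK
term gate whose monotone circuit complexity OVER ITS ATOMS is `≤ m^{(3/4 - o(1))·lOf m}` (numerics in the note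
stubs/SG-sharpening.md §2) — all s–t-connectivity / series–parallel / formula gadgets, in particular every one-gate
construction in `Disproof.lean` at `d = m^c`. The research content of `stub_sgPerm` / `stub_sgGRank` is thereby confined to
term gates of SUPERPOLYNOMIAL monotone complexity over atoms (span-program / rank type).

`atomB`, `lostPos`, `gainedNeg` are VERBATIM copies of the skeleton's §2 definitions.
-/

set_option linter.dupNamespace false

namespace Summit.PneNP.PneNP.Cruxes.LinAlgGateBlind.DnfInvariantWideGatesSeeSmallCliques.DrefuteG2M

open Finset Literature.Computability.Complexity Razborov

noncomputable section

variable {m : ℕ}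

/-! ### Verbatim copies of the skeleton's §2 definitions -/

open Classical in
/-- (copy of the skeleton's `atomB`) -/
def atomB {m : ℕ} (X : Finset (Fin m)) (x : KEdge m → Bool) : Bool := decide (CliquePresent X x)

open Classical in
/-- (copy of the skeleton's `lostPos`) -/
def lostPos (m k : ℕ) (O : (KEdge m → Bool) → Bool) (𝒜 : Finset (Finset (Fin m))) :
    Finset (Finset (Fin m)) :=
  (powersetCard k (univ : Finset (Fin m))).filter fun S =>
    O (cliqueVec S) = true ∧ ¬ Accepts 𝒜 (cliqueVec S)

/-- (copy of the skeleton's `gainedNeg`) -/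
def gainedNeg (m : ℕ) (q : ℝ) (O : (KEdge m → Bool) → Bool) (𝒜 : Finset (Finset (Fin m))) : ℝ :=
  prob q (fun x : KEdge m → Bool => O x = false ∧ Accepts 𝒜 x)

/-! ### Atoms as input variables -/

/-- The atom index type: small vertex sets `Y ∈ 𝒱(l)`. [folklore] -/
abbrev Atom (m l : ℕ) : Type := {Y : Finset (Fin m) // Y ∈ smallSets (Fin m) l}

/-- The atom vector `(⌈Y⌉(x))_{Y ∈ 𝒱(l)}` of a graph `x`. [folklore] -/
def atomVec (l : ℕ) (x : KEdge m → Bool) : Atom m l → Bool := fun Y => atomB Y.1 x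

/-- `atomFamily l Y = {W ∈ 𝒱(l) : Y ⊆ W}`, the principal up-set of `Y` inside `𝒱(l)`. [folklore] -/
def atomFamily (l : ℕ) (Y : Finset (Fin m)) : Finset (Finset (Fin m)) :=
  (smallSets (Fin m) l).filter fun W => Y ⊆ W

theorem mem_atomFamily {l : ℕ} {Y W : Finset (Fin m)} :
    W ∈ atomFamily l Y ↔ W ∈ smallSets (Fin m) l ∧ Y ⊆ W := by
  simp [atomFamily]

theorem atomFamily_subset (l : ℕ) (Y : Finset (Fin m)) : atomFamily l Y ⊆ smallSets (Fin m) l :=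
  filter_subset _ _

/-- The principal up-set of a small set is closed in `K(m, r, l)` for `r ≥ 2`. -/
theorem isClosedFamily_atomFamily {r l : ℕ} (hr : 2 ≤ r) {Y : Finset (Fin m)}
    (hY : Y ∈ smallSets (Fin m) l) : IsClosedFamily r l (atomFamily l Y) := by
  classical
  refine ⟨filter_subset _ _, fun U hUl hI => ?_⟩
  obtain ⟨W, hW, hWU⟩ := hI
  set i0 : Fin r := ⟨0, by omega⟩
  set i1 : Fin r := ⟨1, by omega⟩
  have h0 : Y ⊆ W i0 := (mem_atomFamily.1 (hW i0)).2
  have h1 : Y ⊆ W i1 := (mem_atomFamily.1 (hW i1)).2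
  have hsub : W i0 ∩ W i1 ⊆ U := hWU i0 i1 (by simp [i0, i1, Fin.ext_iff])
  have hYU : Y ⊆ U := fun a ha => hsub (mem_inter.2 ⟨h0 ha, h1 ha⟩)
  rw [mem_atomFamily]
  refine ⟨canon_mem_smallSets hUl, ?_⟩
  by_cases hU1 : #U ≤ 1
  · rw [canon_eq_empty hU1]
    have hY1 : #Y ≠ 1 := (mem_smallSets.1 hY).2
    have hYle : #Y ≤ 1 := (card_le_card hYU).trans hU1
    have hY0 : Y = ∅ := by rw [← card_eq_zero]; omega
    rw [hY0]
  · rw [canon_eq_self (by omega)]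
    exact hYU

/-! ### The semantics of a family on an arbitrary atom assignment -/

open Classical in
/-- `famVal l F a`: some member `W ∈ F` has ALL members `W' ⊆ W` of `F` switched on in the atom assignment `a`.
On the atom vector of a graph this is `⌈F⌉` (`famVal_atomVec`); on the principal up-set of `Y` it is the
coordinate `a Y` for EVERY assignment `a` (`famVal_atomFamily`), as `ApproxScheme.val_inp` demands. [folklore] -/
def famVal (l : ℕ) (F : Finset (Finset (Fin m))) (a : Atom m l → Bool) : Bool :=
  decide (∃ W ∈ F, ∀ W' ∈ F, ∀ h : W' ∈ smallSets (Fin m) l, W' ⊆ W → a ⟨W', h⟩ = true)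

theorem famVal_atomFamily {l : ℕ} (Y : Atom m l) (a : Atom m l → Bool) :
    famVal l (atomFamily l Y.1) a = a Y := by
  classical
  obtain ⟨Y, hY⟩ := Y
  unfold famVal
  rcases ha : a ⟨Y, hY⟩ with _ | _
  · rw [decide_eq_false_iff_not]
    rintro ⟨W, hW, hall⟩
    have h := hall Y (mem_atomFamily.2 ⟨hY, Subset.rfl⟩) hY (mem_atomFamily.1 hW).2
    rw [ha] at h
    exact absurd h (by decide)
  · rw [decide_eq_true_iff]
    refine ⟨Y, mem_atomFamily.2 ⟨hY, Subset.rfl⟩, fun W' hW' h hW'Y => ?_⟩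
    have hYW' : Y ⊆ W' := (mem_atomFamily.1 hW').2
    have heq : W' = Y := Subset.antisymm hW'Y hYW'
    subst heq
    exact ha

theorem famVal_atomVec {l : ℕ} {F : Finset (Finset (Fin m))} (hF : F ⊆ smallSets (Fin m) l)
    (x : KEdge m → Bool) : famVal l F (atomVec l x) = true ↔ Accepts F x := by
  classical
  unfold famVal
  rw [decide_eq_true_iff]
  constructor
  · rintro ⟨W, hW, hall⟩
    have h := hall W hW (hF hW) Subset.rfl
    simp only [atomVec, atomB, decide_eq_true_eq] at h
    exact ⟨W, hW, h⟩
  · rintro ⟨W, hW, hWx⟩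
    refine ⟨W, hW, fun W' _ _ hW'W => ?_⟩
    simp only [atomVec, atomB, decide_eq_true_eq]
    exact hWx.anti hW'W

theorem famVal_atomVec_eq_false {l : ℕ} {F : Finset (Finset (Fin m))} (hF : F ⊆ smallSets (Fin m) l)
    (x : KEdge m → Bool) : famVal l F (atomVec l x) = false ↔ ¬ Accepts F x := by
  rw [← famVal_atomVec hF x, Bool.eq_false_iff]

/-! ### The approximation scheme on atoms -/

/-- Closed families of `K(m, r, l)` as an `ApproxScheme` over the ATOM variables (`r ≥ 2`). [folklore] -/
def atomScheme (m r l : ℕ) (hr : 2 ≤ r) : ApproxScheme (Atom m l) (Finset (Finset (Fin m))) where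
  ok F := IsClosedFamily r l F
  val F a := famVal l F a
  sup A B := closure r l (A ∪ B)
  inf A B := A ∩ B
  inp Y := atomFamily l Y.1
  ok_inp Y := isClosedFamily_atomFamily hr Y.2
  ok_sup A B _ _ := isClosedFamily_closure r l (A ∪ B)
  ok_inf _ _ hA hB := hA.inter hB
  val_inp Y a := famVal_atomFamily Y a

/-- **The reduction.** A Boolean function of graphs computed from the atom vector by a `{∧₂, ∨₂}`-circuit `C`
has a closed one-sided approximator losing `≤ C.size · ((r-1)^l)^2 · C(m-l-1,k-l-1)` bare `k`-cliques and
gaining `≤ C.size · pluck` mass of `G(m,q)`, for any uniform plucking bound `pluck`. -/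
theorem exists_closed_approx_of_monotoneCircuit {k r l : ℕ} {q : ℝ} (hr : 2 ≤ r) (hq0 : 0 ≤ q)
    (hq1 : q ≤ 1) (pluck : ℝ)
    (hPluck : ∀ 𝒞 : Finset (Finset (Fin m)), 𝒞 ⊆ smallSets (Fin m) l →
      prob q (fun x : KEdge m → Bool => Accepts (closure r l 𝒞) x ∧ ¬ Accepts 𝒞 x) ≤ pluck)
    (C : Circuit (Atom m l)) (hC : C.IsOver monotoneBasis) (O : (KEdge m → Bool) → Bool)
    (hO : ∀ x, O x = C.eval (atomVec l x)) :
    ∃ F : Finset (Finset (Fin m)), IsClosedFamily r l F ∧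
      (#(lostPos m k O F) : ℝ) ≤ C.size * ((((r - 1) ^ l) ^ 2 * (m - (l + 1)).choose (k - (l + 1)) : ℕ) : ℝ) ∧
      gainedNeg m q O F ≤ C.size * pluck := by
  classical
  set S := atomScheme m r l hr with hS
  set trim : ℕ := ((r - 1) ^ l) ^ 2 * (m - (l + 1)).choose (k - (l + 1)) with htrim
  have hpluck0 : 0 ≤ pluck := le_trans (prob_nonneg hq0 hq1 _) (hPluck ∅ (empty_subset _))
  -- semantics of `ok` families on atom vectors
  have hval : ∀ {F : Finset (Finset (Fin m))}, S.ok F → ∀ x, S.val F (atomVec l x) = true ↔ Accepts F x :=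
    fun hF x => famVal_atomVec hF.subset x
  have hvalF : ∀ {F : Finset (Finset (Fin m))}, S.ok F → ∀ x, S.val F (atomVec l x) = false ↔ ¬ Accepts F x :=
    fun hF x => famVal_atomVec_eq_false hF.subset x
  -- approximate `∨` loses no positives
  have hsupP : ∀ a b, S.ok a → S.ok b →
      ∑ _s ∈ S.lostSup (powersetCard k univ) (fun Z => atomVec l (cliqueVec Z)) a b, (1 : ℝ) ≤ (trim : ℝ) := by
    intro a b ha hb
    have hempty : S.lostSup (powersetCard k univ) (fun Z => atomVec l (cliqueVec Z)) a b = ∅ := by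
      refine filter_eq_empty_iff.2 fun Z _ h => ?_
      obtain ⟨hab, hsup⟩ := h
      have hokS : S.ok (S.sup a b) := S.ok_sup a b ha hb
      rw [hvalF hokS] at hsup
      rw [Bool.or_eq_true, hval ha, hval hb] at hab
      refine hsup ?_
      have hAB : Accepts (a ∪ b) (cliqueVec Z) := accepts_union_iff.2 hab
      exact hAB.mono (subset_closure (union_subset ha.subset hb.subset))
    rw [hempty, sum_empty]
    exact_mod_cast Nat.zero_le _
  -- approximate `∧` loses `≤ trim` positives (Alon–Boppana trimming count, tree)
  have hinfP : ∀ a b, S.ok a → S.ok b →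
      ∑ _s ∈ S.lostInf (powersetCard k univ) (fun Z => atomVec l (cliqueVec Z)) a b, (1 : ℝ) ≤ (trim : ℝ) := by
    intro a b ha hb
    have hsub : S.lostInf (powersetCard k univ) (fun Z => atomVec l (cliqueVec Z)) a b ⊆ errPos k a b := by
      intro Z hZ
      obtain ⟨hZk, hab, hinf⟩ := mem_filter.1 hZ
      rw [Bool.and_eq_true, hval ha, hval hb] at hab
      have hokI : S.ok (S.inf a b) := S.ok_inf a b ha hb
      rw [hvalF hokI] at hinf
      exact mem_errPos.2 ⟨(mem_powersetCard.1 hZk).2, hab.1, hab.2, hinf⟩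
    calc ∑ _s ∈ S.lostInf (powersetCard k univ) (fun Z => atomVec l (cliqueVec Z)) a b, (1 : ℝ)
        = #(S.lostInf (powersetCard k univ) (fun Z => atomVec l (cliqueVec Z)) a b) := by simp
      _ ≤ #(errPos k a b) := by exact_mod_cast card_le_card hsub
      _ ≤ (trim : ℝ) := by exact_mod_cast card_errPos_le_wide hr ha hb
  -- approximate `∨` gains `≤ pluck` (the plucking hypothesis)
  have hsupN : ∀ a b, S.ok a → S.ok b →
      ∑ x ∈ S.gainedSup univ (fun x => atomVec l x) a b, pw q x ≤ pluck := by
    intro a b ha hb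
    have hokS : S.ok (S.sup a b) := S.ok_sup a b ha hb
    calc ∑ x ∈ S.gainedSup univ (fun x => atomVec l x) a b, pw q x
        ≤ ∑ x ∈ univ.filter (fun x : KEdge m → Bool =>
            Accepts (closure r l (a ∪ b)) x ∧ ¬ Accepts (a ∪ b) x), pw q x := by
          refine sum_le_sum_of_subset_of_nonneg (fun x hx => ?_) fun x _ _ => pw_nonneg hq0 hq1 x
          obtain ⟨-, hab, hsup⟩ := mem_filter.1 hx
          rw [hval hokS] at hsup
          refine mem_filter.2 ⟨mem_univ _, hsup, fun hAB => ?_⟩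
          rw [Bool.or_eq_false_iff, hvalF ha, hvalF hb] at hab
          rcases accepts_union_iff.1 hAB with h | h
          · exact hab.1 h
          · exact hab.2 h
      _ = prob q (fun x : KEdge m → Bool => Accepts (closure r l (a ∪ b)) x ∧ ¬ Accepts (a ∪ b) x) :=
          (prob_eq q _).symm
      _ ≤ pluck := hPluck (a ∪ b) (union_subset ha.subset hb.subset)
  -- approximate `∧` gains nothing
  have hinfN : ∀ a b, S.ok a → S.ok b →
      ∑ x ∈ S.gainedInf univ (fun x => atomVec l x) a b, pw q x ≤ pluck := by
    intro a b ha hb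
    have hempty : S.gainedInf univ (fun x => atomVec l x) a b = ∅ := by
      refine filter_eq_empty_iff.2 fun x _ h => ?_
      obtain ⟨hab, hinf⟩ := h
      have hokI : S.ok (S.inf a b) := S.ok_inf a b ha hb
      rw [hval hokI] at hinf
      rw [Bool.and_eq_false_iff, hvalF ha, hvalF hb] at hab
      rcases hab with h | h
      · exact h (hinf.mono inter_subset_left)
      · exact h (hinf.mono inter_subset_right)
    rw [hempty, sum_empty]
    exact hpluck0
  obtain ⟨F, BadP, BadN, hok, hcP, hcN, hpos, hneg⟩ :=
    S.exists_approx_circuit (powersetCard k (univ : Finset (Fin m)))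
      (fun Z => atomVec l (cliqueVec Z)) (fun _ => (1 : ℝ)) (univ : Finset (KEdge m → Bool))
      (fun x => atomVec l x) (fun x => pw q x) (fun _ => zero_le_one) (fun x => pw_nonneg hq0 hq1 x)
      (trim : ℝ) pluck hsupP hinfP hsupN hinfN C hC (f := fun a => C.eval a) (fun _ => rfl)
  refine ⟨F, hok, ?_, ?_⟩
  · -- lost positives lie in `BadP`
    have hsub : lostPos m k O F ⊆ BadP := by
      intro Z hZ
      simp only [lostPos, mem_filter] at hZ
      obtain ⟨hZk, hOZ, hnacc⟩ := hZ
      by_contra hB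
      have h := hpos Z hZk hB (by rw [← hO]; exact hOZ)
      exact hnacc ((hval hok _).1 h)
    calc (#(lostPos m k O F) : ℝ) ≤ #BadP := by exact_mod_cast card_le_card hsub
      _ = ∑ _s ∈ BadP, (1 : ℝ) := by simp
      _ ≤ C.size * (trim : ℝ) := hcP
  · -- gained negatives lie in `BadN`
    unfold gainedNeg
    rw [prob_eq]
    calc ∑ x ∈ univ.filter (fun x : KEdge m → Bool => O x = false ∧ Accepts F x), pw q x
        ≤ ∑ x ∈ BadN, pw q x := by
          refine sum_le_sum_of_subset_of_nonneg (fun x hx => ?_) fun x _ _ => pw_nonneg hq0 hq1 x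
          obtain ⟨-, hOx, hacc⟩ := mem_filter.1 hx
          by_contra hB
          have h := hneg x (mem_univ _) hB ((hval hok _).2 hacc)
          rw [← hO, hOx] at h
          exact Bool.false_ne_true h
      _ ≤ C.size * pluck := hcN

/-- **Corollary (SG form).** If the circuit is small against the two budgets, the SG goal holds for `O` — the
conclusion of the skeleton's `SGAt`, with a CLOSED witness. -/
theorem sgGoal_of_monotoneCircuit {k r l : ℕ} {q ε : ℝ} (hr : 2 ≤ r) (hq0 : 0 ≤ q) (hq1 : q ≤ 1)
    (pluck : ℝ)
    (hPluck : ∀ 𝒞 : Finset (Finset (Fin m)), 𝒞 ⊆ smallSets (Fin m) l →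
      prob q (fun x : KEdge m → Bool => Accepts (closure r l 𝒞) x ∧ ¬ Accepts 𝒞 x) ≤ pluck)
    (C : Circuit (Atom m l)) (hC : C.IsOver monotoneBasis) (O : (KEdge m → Bool) → Bool)
    (hO : ∀ x, O x = C.eval (atomVec l x))
    (hP : (C.size : ℝ) * ((((r - 1) ^ l) ^ 2 * (m - (l + 1)).choose (k - (l + 1)) : ℕ) : ℝ)
      ≤ ε * (m.choose k : ℝ))
    (hN : (C.size : ℝ) * pluck ≤ ε) :
    ∃ 𝒜 ⊆ smallSets (Fin m) l, IsClosedFamily r l 𝒜 ∧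
      (#(lostPos m k O 𝒜) : ℝ) ≤ ε * (m.choose k : ℝ) ∧ gainedNeg m q O 𝒜 ≤ ε := by
  obtain ⟨F, hF, hlost, hgain⟩ :=
    exists_closed_approx_of_monotoneCircuit hr hq0 hq1 pluck hPluck C hC O hO (k := k)
  exact ⟨F, hF.subset, hF, hlost.trans hP, hgain.trans hN⟩


/-! ### Refinement: separate `∧`/`∨` accounting

In the atom scheme an approximate `∨` loses NO positives and an approximate `∧` gains NO negatives, so only the
`∧`-gates should be charged the trimming error and only the `∨`-gates the plucking error. The tree's generic
bookkeeping `ApproxScheme.exists_approx_gates` charges one `δP`, `δN` per gate; the copies below (same proof, four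
budgets) charge `∧` and `∨` separately (`andCount`, `orCount`). -/

section Weighted

open GateList

variable {ι β σ τ : Type*}

/-- `∧₂ ≠ ∨₂` (copy of `CircuitLP.gateFn_and_two_ne_or_two`, to keep the imports small). [folklore] -/
theorem gateFn_and_two_ne_or_two : GateFn.and 2 ≠ GateFn.or 2 := by
  intro h
  have h2 := (Sigma.mk.inj_iff.1 h).2
  have h3 := congrFun (eq_of_heq h2) (fun i : Fin 2 => decide (i = 0))
  revert h3
  decide

open Classical in
/-- The number of `∧₂` gates of a gate list. [folklore] -/
def andCount (gs : List (Gate ι)) : ℕ := (gs.map fun g => if g.fn = GateFn.and 2 then 1 else 0).sum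

open Classical in
/-- The number of `∨₂` gates of a gate list. [folklore] -/
def orCount (gs : List (Gate ι)) : ℕ := (gs.map fun g => if g.fn = GateFn.or 2 then 1 else 0).sum

@[simp] theorem andCount_nil : andCount ([] : List (Gate ι)) = 0 := by simp [andCount]
@[simp] theorem orCount_nil : orCount ([] : List (Gate ι)) = 0 := by simp [orCount]

@[simp] theorem andCount_append_andGate (gs : List (Gate ι)) (u v : ι ⊕ ℕ) :
    andCount (gs ++ [andGate u v]) = andCount gs + 1 := by
  simp [andCount, List.map_append, List.sum_append]

@[simp] theorem andCount_append_orGate (gs : List (Gate ι)) (u v : ι ⊕ ℕ) :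
    andCount (gs ++ [orGate u v]) = andCount gs := by
  simp [andCount, List.map_append, List.sum_append, Ne.symm gateFn_and_two_ne_or_two]

@[simp] theorem orCount_append_orGate (gs : List (Gate ι)) (u v : ι ⊕ ℕ) :
    orCount (gs ++ [orGate u v]) = orCount gs + 1 := by
  simp [orCount, List.map_append, List.sum_append]

@[simp] theorem orCount_append_andGate (gs : List (Gate ι)) (u v : ι ⊕ ℕ) :
    orCount (gs ++ [andGate u v]) = orCount gs := by
  simp [orCount, List.map_append, List.sum_append, gateFn_and_two_ne_or_two]

/-- `andCount`/`orCount` are at most the length. [folklore] -/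
theorem andCount_le_length (gs : List (Gate ι)) : andCount gs ≤ gs.length := by
  classical
  unfold andCount
  induction gs with
  | nil => simp
  | cons g gs ih =>
    simp only [List.map_cons, List.sum_cons, List.length_cons]
    split_ifs <;> omega

theorem orCount_le_length (gs : List (Gate ι)) : orCount gs ≤ gs.length := by
  classical
  unfold orCount
  induction gs with
  | nil => simp
  | cons g gs ih =>
    simp only [List.map_cons, List.sum_cons, List.length_cons]
    split_ifs <;> omega

namespace ApproxSchemeWt

variable (S : ApproxScheme ι β) [DecidableEq σ] [DecidableEq τ] [Inhabited β]

/-- **The approximation method along a straight-line program, with separate `∧`/`∨` budgets** (same proof as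
the tree's `ApproxScheme.exists_approx_gates`). [cite: AlonBoppana1987, Thm. 2.1] -/
theorem exists_approx_gates_wt (P : Finset σ) (ptP : σ → ι → Bool) (wP : σ → ℝ) (N : Finset τ)
    (ptN : τ → ι → Bool) (wN : τ → ℝ) (hwP : ∀ s, 0 ≤ wP s) (hwN : ∀ s, 0 ≤ wN s)
    (δPo δPa δNo δNa : ℝ)
    (hsupP : ∀ a b, S.ok a → S.ok b → ∑ s ∈ S.lostSup P ptP a b, wP s ≤ δPo)
    (hinfP : ∀ a b, S.ok a → S.ok b → ∑ s ∈ S.lostInf P ptP a b, wP s ≤ δPa)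
    (hsupN : ∀ a b, S.ok a → S.ok b → ∑ s ∈ S.gainedSup N ptN a b, wN s ≤ δNo)
    (hinfN : ∀ a b, S.ok a → S.ok b → ∑ s ∈ S.gainedInf N ptN a b, wN s ≤ δNa) :
    ∀ gs : List (Gate ι), WF gs → (∀ gt ∈ gs, gt.fn ∈ monotoneBasis) →
      ∃ (ap : ι ⊕ ℕ → β) (BadP : Finset σ) (BadN : Finset τ),
        ∑ s ∈ BadP, wP s ≤ orCount gs * δPo + andCount gs * δPa ∧
        ∑ s ∈ BadN, wN s ≤ orCount gs * δNo + andCount gs * δNa ∧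
        ∀ w : ι ⊕ ℕ, OutOK gs.length w →
          S.WireApprox P ptP N ptN BadP BadN (ap w) fun x => wireOf x (vals gs x) w := by
  classical
  intro gs
  induction gs using List.reverseRecOn with
  | nil =>
    intro _ _
    refine ⟨fun w => match w with
      | .inl i => S.inp i
      | .inr _ => default, ∅, ∅, by simp, by simp, fun w hw => ?_⟩
    rcases w with i | m
    · exact ApproxScheme.WireApprox.input S P ptP N ptN i
    · exact absurd (hw m rfl) (by simp)
  | append_singleton gs gt ih =>
    intro hwf hB
    obtain ⟨ap, BadP, BadN, hcP, hcN, hinv⟩ :=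
      ih hwf.of_append_left fun g' hg' => hB g' (List.mem_append_left _ hg')
    have hgOK : GateOK gs.length gt := hwf.gateOK_mid (post := [])
    have hgB : gt.fn ∈ monotoneBasis := hB gt (by simp)
    -- old wires keep their values and invariants
    have hold : ∀ (BadP' : Finset σ) (BadN' : Finset τ), BadP ⊆ BadP' → BadN ⊆ BadN' →
        ∀ w : ι ⊕ ℕ, OutOK gs.length w →
        S.WireApprox P ptP N ptN BadP' BadN' (ap w) (fun x => wireOf x (vals (gs ++ [gt]) x) w) :=
      fun BadP' BadN' hP' hN' w hw =>
        ((hinv w hw).mono hP' hN').congr fun x => (wireOf_vals_append gs [gt] x w hw).symm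
    -- the value of the new gate
    have hnew : ∀ x, wireOf x (vals (gs ++ [gt]) x) (.inr gs.length) =
        gt.op (fun a => wireOf x (vals gs x) (gt.args a)) := fun x => by
      rw [wireOf_inr, show gs ++ [gt] = gs ++ gt :: [] from rfl, getD_vals_append_cons]
    -- how to assemble the conclusion from an approximator of the new gate
    have assemble : ∀ (BadP' : Finset σ) (BadN' : Finset τ) (Fn : β) (TP TN : ℝ),
        BadP ⊆ BadP' → BadN ⊆ BadN' →
        ∑ s ∈ BadP', wP s ≤ TP → ∑ s ∈ BadN', wN s ≤ TN →
        S.WireApprox P ptP N ptN BadP' BadN' Fn (fun x => wireOf x (vals (gs ++ [gt]) x) (.inr gs.length)) →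
        ∃ (ap : ι ⊕ ℕ → β) (BadP : Finset σ) (BadN : Finset τ),
          ∑ s ∈ BadP, wP s ≤ TP ∧ ∑ s ∈ BadN, wN s ≤ TN ∧
          ∀ w : ι ⊕ ℕ, OutOK (gs ++ [gt]).length w →
            S.WireApprox P ptP N ptN BadP BadN (ap w) (fun x => wireOf x (vals (gs ++ [gt]) x) w) := by
      intro BadP' BadN' Fn TP TN hPP' hNN' hcP' hcN' hnewinv
      refine ⟨fun w => if w = .inr gs.length then Fn else ap w, BadP', BadN', hcP', hcN',
        fun w hw => ?_⟩
      by_cases hwn : w = .inr gs.length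
      · subst hwn
        simpa using hnewinv
      · dsimp only
        rw [if_neg hwn]
        refine hold BadP' BadN' hPP' hNN' w fun n hn => ?_
        have h1 := hw n hn
        simp only [List.length_append, List.length_singleton] at h1
        have h2 : n ≠ gs.length := fun h => hwn (hn.trans (by rw [h]))
        omega
    simp only [monotoneBasis, Set.mem_insert_iff, Set.mem_singleton_iff] at hgB
    rcases hgB with hc | hc
    · -- AND gate
      obtain ⟨u, v, rfl⟩ := exists_eq_andGate_of_fn_eq hc
      have hu : OutOK gs.length u := fun n hn => hgOK (0 : Fin 2) n hn
      have hv : OutOK gs.length v := fun n hn => hgOK (1 : Fin 2) n hn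
      have hnewinv := ApproxScheme.WireApprox.and_gate (hinv u hu) (hinv v hv)
      have hcP' : ∑ s ∈ BadP ∪ S.lostInf P ptP (ap u) (ap v), wP s
          ≤ orCount (gs ++ [andGate u v]) * δPo + andCount (gs ++ [andGate u v]) * δPa :=
        calc ∑ s ∈ BadP ∪ S.lostInf P ptP (ap u) (ap v), wP s
            ≤ ∑ s ∈ BadP, wP s + ∑ s ∈ S.lostInf P ptP (ap u) (ap v), wP s :=
              ApproxScheme.sum_union_le_of_nonneg hwP _ _
          _ ≤ (orCount gs * δPo + andCount gs * δPa) + δPa :=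
              add_le_add hcP (hinfP _ _ (hinv u hu).ok (hinv v hv).ok)
          _ = orCount (gs ++ [andGate u v]) * δPo + andCount (gs ++ [andGate u v]) * δPa := by
              rw [orCount_append_andGate, andCount_append_andGate]; push_cast; ring
      have hcN' : ∑ s ∈ BadN ∪ S.gainedInf N ptN (ap u) (ap v), wN s
          ≤ orCount (gs ++ [andGate u v]) * δNo + andCount (gs ++ [andGate u v]) * δNa :=
        calc ∑ s ∈ BadN ∪ S.gainedInf N ptN (ap u) (ap v), wN s
            ≤ ∑ s ∈ BadN, wN s + ∑ s ∈ S.gainedInf N ptN (ap u) (ap v), wN s :=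
              ApproxScheme.sum_union_le_of_nonneg hwN _ _
          _ ≤ (orCount gs * δNo + andCount gs * δNa) + δNa :=
              add_le_add hcN (hinfN _ _ (hinv u hu).ok (hinv v hv).ok)
          _ = orCount (gs ++ [andGate u v]) * δNo + andCount (gs ++ [andGate u v]) * δNa := by
              rw [orCount_append_andGate, andCount_append_andGate]; push_cast; ring
      refine assemble _ _ _ _ _ subset_union_left subset_union_left hcP' hcN' (hnewinv.congr fun x => ?_)
      rw [hnew, andGate_op]
    · -- OR gate
      obtain ⟨u, v, rfl⟩ := exists_eq_orGate_of_fn_eq hc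
      have hu : OutOK gs.length u := fun n hn => hgOK (0 : Fin 2) n hn
      have hv : OutOK gs.length v := fun n hn => hgOK (1 : Fin 2) n hn
      have hnewinv := ApproxScheme.WireApprox.or_gate (hinv u hu) (hinv v hv)
      have hcP' : ∑ s ∈ BadP ∪ S.lostSup P ptP (ap u) (ap v), wP s
          ≤ orCount (gs ++ [orGate u v]) * δPo + andCount (gs ++ [orGate u v]) * δPa :=
        calc ∑ s ∈ BadP ∪ S.lostSup P ptP (ap u) (ap v), wP s
            ≤ ∑ s ∈ BadP, wP s + ∑ s ∈ S.lostSup P ptP (ap u) (ap v), wP s :=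
              ApproxScheme.sum_union_le_of_nonneg hwP _ _
          _ ≤ (orCount gs * δPo + andCount gs * δPa) + δPo :=
              add_le_add hcP (hsupP _ _ (hinv u hu).ok (hinv v hv).ok)
          _ = orCount (gs ++ [orGate u v]) * δPo + andCount (gs ++ [orGate u v]) * δPa := by
              rw [orCount_append_orGate, andCount_append_orGate]; push_cast; ring
      have hcN' : ∑ s ∈ BadN ∪ S.gainedSup N ptN (ap u) (ap v), wN s
          ≤ orCount (gs ++ [orGate u v]) * δNo + andCount (gs ++ [orGate u v]) * δNa :=
        calc ∑ s ∈ BadN ∪ S.gainedSup N ptN (ap u) (ap v), wN s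
            ≤ ∑ s ∈ BadN, wN s + ∑ s ∈ S.gainedSup N ptN (ap u) (ap v), wN s :=
              ApproxScheme.sum_union_le_of_nonneg hwN _ _
          _ ≤ (orCount gs * δNo + andCount gs * δNa) + δNo :=
              add_le_add hcN (hsupN _ _ (hinv u hu).ok (hinv v hv).ok)
          _ = orCount (gs ++ [orGate u v]) * δNo + andCount (gs ++ [orGate u v]) * δNa := by
              rw [orCount_append_orGate, andCount_append_orGate]; push_cast; ring
      refine assemble _ _ _ _ _ subset_union_left subset_union_left hcP' hcN' (hnewinv.congr fun x => ?_)
      rw [hnew, orGate_op]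

omit [DecidableEq σ] [DecidableEq τ] [Inhabited β] in
/-- **The approximation method for a monotone circuit, separate `∧`/`∨` budgets.** [cite: AlonBoppana1987, Thm. 2.1] -/
theorem exists_approx_circuit_wt [DecidableEq σ] [DecidableEq τ] [Inhabited β] (P : Finset σ)
    (ptP : σ → ι → Bool) (wP : σ → ℝ) (N : Finset τ)
    (ptN : τ → ι → Bool) (wN : τ → ℝ) (hwP : ∀ s, 0 ≤ wP s) (hwN : ∀ s, 0 ≤ wN s)
    (δPo δPa δNo δNa : ℝ)
    (hsupP : ∀ a b, S.ok a → S.ok b → ∑ s ∈ S.lostSup P ptP a b, wP s ≤ δPo)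
    (hinfP : ∀ a b, S.ok a → S.ok b → ∑ s ∈ S.lostInf P ptP a b, wP s ≤ δPa)
    (hsupN : ∀ a b, S.ok a → S.ok b → ∑ s ∈ S.gainedSup N ptN a b, wN s ≤ δNo)
    (hinfN : ∀ a b, S.ok a → S.ok b → ∑ s ∈ S.gainedInf N ptN a b, wN s ≤ δNa)
    (C : Circuit ι) (hC : C.IsOver monotoneBasis) {f : (ι → Bool) → Bool} (hf : C.Computes f) :
    ∃ (a : β) (BadP : Finset σ) (BadN : Finset τ), S.ok a ∧
      ∑ s ∈ BadP, wP s ≤ orCount C.gates * δPo + andCount C.gates * δPa ∧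
      ∑ s ∈ BadN, wN s ≤ orCount C.gates * δNo + andCount C.gates * δNa ∧
      (∀ s ∈ P, s ∉ BadP → f (ptP s) = true → S.val a (ptP s) = true) ∧
      (∀ s ∈ N, s ∉ BadN → S.val a (ptN s) = true → f (ptN s) = true) := by
  obtain ⟨ap, BadP, BadN, hcP, hcN, hinv⟩ :=
    exists_approx_gates_wt S P ptP wP N ptN wN hwP hwN δPo δPa δNo δNa hsupP hinfP hsupN hinfN C.gates
      (wf_gates C) hC
  have h := hinv C.output C.wf_output
  refine ⟨ap C.output, BadP, BadN, h.ok, hcP, hcN, fun s hs hsB hfs => h.pos s hs hsB ?_,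
    fun s hs hsB ha => ?_⟩
  · rw [← hfs, ← hf, circuit_eval]
  · have := h.neg s hs hsB ha
    rwa [← circuit_eval, hf] at this

end ApproxSchemeWt

end Weighted

/-- **The reduction, sharp accounting.** As `exists_closed_approx_of_monotoneCircuit`, but only the `∧`-gates pay
the trimming error and only the `∨`-gates pay the plucking error:
`#lostPos ≤ andCount · ((r-1)^l)^2 · C(m-l-1,k-l-1)`, `gainedNeg ≤ orCount · pluck`. -/
theorem exists_closed_approx_of_monotoneCircuit_wt {k r l : ℕ} {q : ℝ} (hr : 2 ≤ r) (hq0 : 0 ≤ q)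
    (hq1 : q ≤ 1) (pluck : ℝ)
    (hPluck : ∀ 𝒞 : Finset (Finset (Fin m)), 𝒞 ⊆ smallSets (Fin m) l →
      prob q (fun x : KEdge m → Bool => Accepts (closure r l 𝒞) x ∧ ¬ Accepts 𝒞 x) ≤ pluck)
    (C : Circuit (Atom m l)) (hC : C.IsOver monotoneBasis) (O : (KEdge m → Bool) → Bool)
    (hO : ∀ x, O x = C.eval (atomVec l x)) :
    ∃ F : Finset (Finset (Fin m)), IsClosedFamily r l F ∧
      (#(lostPos m k O F) : ℝ)
        ≤ andCount C.gates * ((((r - 1) ^ l) ^ 2 * (m - (l + 1)).choose (k - (l + 1)) : ℕ) : ℝ) ∧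
      gainedNeg m q O F ≤ orCount C.gates * pluck := by
  classical
  set S := atomScheme m r l hr with hS
  set trim : ℕ := ((r - 1) ^ l) ^ 2 * (m - (l + 1)).choose (k - (l + 1)) with htrim
  have hval : ∀ {F : Finset (Finset (Fin m))}, S.ok F → ∀ x, S.val F (atomVec l x) = true ↔ Accepts F x :=
    fun hF x => famVal_atomVec hF.subset x
  have hvalF : ∀ {F : Finset (Finset (Fin m))}, S.ok F → ∀ x, S.val F (atomVec l x) = false ↔ ¬ Accepts F x :=
    fun hF x => famVal_atomVec_eq_false hF.subset x
  -- approximate `∨` loses no positives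
  have hsupP : ∀ a b, S.ok a → S.ok b →
      ∑ _s ∈ S.lostSup (powersetCard k univ) (fun Z => atomVec l (cliqueVec Z)) a b, (1 : ℝ) ≤ 0 := by
    intro a b ha hb
    have hempty : S.lostSup (powersetCard k univ) (fun Z => atomVec l (cliqueVec Z)) a b = ∅ := by
      refine filter_eq_empty_iff.2 fun Z _ h => ?_
      obtain ⟨hab, hsup⟩ := h
      have hokS : S.ok (S.sup a b) := S.ok_sup a b ha hb
      rw [hvalF hokS] at hsup
      rw [Bool.or_eq_true, hval ha, hval hb] at hab
      refine hsup ?_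
      have hAB : Accepts (a ∪ b) (cliqueVec Z) := accepts_union_iff.2 hab
      exact hAB.mono (subset_closure (union_subset ha.subset hb.subset))
    rw [hempty, sum_empty]
  -- approximate `∧` loses `≤ trim` positives
  have hinfP : ∀ a b, S.ok a → S.ok b →
      ∑ _s ∈ S.lostInf (powersetCard k univ) (fun Z => atomVec l (cliqueVec Z)) a b, (1 : ℝ) ≤ (trim : ℝ) := by
    intro a b ha hb
    have hsub : S.lostInf (powersetCard k univ) (fun Z => atomVec l (cliqueVec Z)) a b ⊆ errPos k a b := by
      intro Z hZ
      obtain ⟨hZk, hab, hinf⟩ := mem_filter.1 hZ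
      rw [Bool.and_eq_true, hval ha, hval hb] at hab
      have hokI : S.ok (S.inf a b) := S.ok_inf a b ha hb
      rw [hvalF hokI] at hinf
      exact mem_errPos.2 ⟨(mem_powersetCard.1 hZk).2, hab.1, hab.2, hinf⟩
    calc ∑ _s ∈ S.lostInf (powersetCard k univ) (fun Z => atomVec l (cliqueVec Z)) a b, (1 : ℝ)
        = #(S.lostInf (powersetCard k univ) (fun Z => atomVec l (cliqueVec Z)) a b) := by simp
      _ ≤ #(errPos k a b) := by exact_mod_cast card_le_card hsub
      _ ≤ (trim : ℝ) := by exact_mod_cast card_errPos_le_wide hr ha hb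
  -- approximate `∨` gains `≤ pluck`
  have hsupN : ∀ a b, S.ok a → S.ok b →
      ∑ x ∈ S.gainedSup univ (fun x => atomVec l x) a b, pw q x ≤ pluck := by
    intro a b ha hb
    have hokS : S.ok (S.sup a b) := S.ok_sup a b ha hb
    calc ∑ x ∈ S.gainedSup univ (fun x => atomVec l x) a b, pw q x
        ≤ ∑ x ∈ univ.filter (fun x : KEdge m → Bool =>
            Accepts (closure r l (a ∪ b)) x ∧ ¬ Accepts (a ∪ b) x), pw q x := by
          refine sum_le_sum_of_subset_of_nonneg (fun x hx => ?_) fun x _ _ => pw_nonneg hq0 hq1 x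
          obtain ⟨-, hab, hsup⟩ := mem_filter.1 hx
          rw [hval hokS] at hsup
          refine mem_filter.2 ⟨mem_univ _, hsup, fun hAB => ?_⟩
          rw [Bool.or_eq_false_iff, hvalF ha, hvalF hb] at hab
          rcases accepts_union_iff.1 hAB with h | h
          · exact hab.1 h
          · exact hab.2 h
      _ = prob q (fun x : KEdge m → Bool => Accepts (closure r l (a ∪ b)) x ∧ ¬ Accepts (a ∪ b) x) :=
          (prob_eq q _).symm
      _ ≤ pluck := hPluck (a ∪ b) (union_subset ha.subset hb.subset)
  -- approximate `∧` gains nothing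
  have hinfN : ∀ a b, S.ok a → S.ok b →
      ∑ x ∈ S.gainedInf univ (fun x => atomVec l x) a b, pw q x ≤ 0 := by
    intro a b ha hb
    have hempty : S.gainedInf univ (fun x => atomVec l x) a b = ∅ := by
      refine filter_eq_empty_iff.2 fun x _ h => ?_
      obtain ⟨hab, hinf⟩ := h
      have hokI : S.ok (S.inf a b) := S.ok_inf a b ha hb
      rw [hval hokI] at hinf
      rw [Bool.and_eq_false_iff, hvalF ha, hvalF hb] at hab
      rcases hab with h | h
      · exact h (hinf.mono inter_subset_left)
      · exact h (hinf.mono inter_subset_right)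
    rw [hempty, sum_empty]
  obtain ⟨F, BadP, BadN, hok, hcP, hcN, hpos, hneg⟩ :=
    ApproxSchemeWt.exists_approx_circuit_wt S (powersetCard k (univ : Finset (Fin m)))
      (fun Z => atomVec l (cliqueVec Z)) (fun _ => (1 : ℝ)) (univ : Finset (KEdge m → Bool))
      (fun x => atomVec l x) (fun x => pw q x) (fun _ => zero_le_one) (fun x => pw_nonneg hq0 hq1 x)
      0 (trim : ℝ) pluck 0 hsupP hinfP hsupN hinfN C hC (f := fun a => C.eval a) (fun _ => rfl)
  refine ⟨F, hok, ?_, ?_⟩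
  · have hsub : lostPos m k O F ⊆ BadP := by
      intro Z hZ
      simp only [lostPos, mem_filter] at hZ
      obtain ⟨hZk, hOZ, hnacc⟩ := hZ
      by_contra hB
      have h := hpos Z hZk hB (by rw [← hO]; exact hOZ)
      exact hnacc ((hval hok _).1 h)
    calc (#(lostPos m k O F) : ℝ) ≤ #BadP := by exact_mod_cast card_le_card hsub
      _ = ∑ _s ∈ BadP, (1 : ℝ) := by simp
      _ ≤ orCount C.gates * 0 + andCount C.gates * (trim : ℝ) := hcP
      _ = andCount C.gates * (trim : ℝ) := by ring
  · unfold gainedNeg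
    rw [prob_eq]
    calc ∑ x ∈ univ.filter (fun x : KEdge m → Bool => O x = false ∧ Accepts F x), pw q x
        ≤ ∑ x ∈ BadN, pw q x := by
          refine sum_le_sum_of_subset_of_nonneg (fun x hx => ?_) fun x _ _ => pw_nonneg hq0 hq1 x
          obtain ⟨-, hOx, hacc⟩ := mem_filter.1 hx
          by_contra hB
          have h := hneg x (mem_univ _) hB ((hval hok _).2 hacc)
          rw [← hO, hOx] at h
          exact Bool.false_ne_true h
      _ ≤ orCount C.gates * pluck + andCount C.gates * 0 := hcN
      _ = orCount C.gates * pluck := by ring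


end

end Summit.PneNP.PneNP.Cruxes.LinAlgGateBlind.DnfInvariantWideGatesSeeSmallCliques.DrefuteG2M
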